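import Mathlib
import Literature.RingTheory.PrincipalIdealRing.MonogenicLocalAlgebraIdeals
import HarnessLib

/-!
# An Artin local algebra with residue field `k` and principal maximal ideal is `k[X]/(Xⁿ)` (Atiyah–Macdonald, Example after
# Prop. 8.8)

Topic `Literature/RingTheory/PrincipalIdealRing`, namespace `Literature.RingTheory.PrincipalIdealRing`.  THEOREMS ONLY (no `def`,
no instance, no named fact), sequel of ★ `MonogenicLocalAlgebraIdeals.lean` (the ideals of such a ring are the `𝔪ʳ`, determined
by their colength); closes that file's `TODO(general form)`.

## Source (read at the page)

M. F. Atiyah, I. G. Macdonald, *Introduction to Commutative Algebra* (1969), Ch. 8, **Proposition 8.8** (an Artin local ring has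
`𝔪` principal iff `dim_k 𝔪/𝔪² ≤ 1`, and then every ideal is `𝔪ʳ = (xʳ)`) and the **Example** following it, VERBATIM: «The rings
`Z/(pⁿ)` (`p` prime), `k[x]/(xⁿ)` (`k` a field) satisfy the conditions of (8.8).»  The classification recorded here — an Artin
local `k`-ALGEBRA with residue field `k` satisfying (8.8) IS `k[X]/(Xⁿ)`, `n` the index of nilpotency of a generator of `𝔪` — is
the standard consequence (every element is `c + (multiple of x)` with `c ∈ k`, so `k[x] → A` is onto, and its kernel is `(Xⁿ)`
because `x^m · (unit) ≠ 0` for `m < n`). [folklore]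

## What is formalised

For a field `k`, a commutative `k`-algebra `A` which is an Artin local ring whose residue field is `k` in the elementwise form
`hres : ∀ a, ∃ c : k, a - algebraMap k A c ∈ 𝔪` (e.g. `k` algebraically closed and `A` finite-dimensional), and a generator `p`
of the maximal ideal (`𝔪 = (p)`; it exists iff `dim 𝔪/𝔪² ≤ 1`, ★ `maximalIdeal_isPrincipal_of_finrank_cotangentSpace_le_one`):
* `aeval_surjective_of_maximalIdeal_eq_span` — the evaluation `k[X] → A`, `X ↦ p`, is SURJECTIVE (A–M's «`𝔞 = (xʳ)`» argument
  run on elements: `a ≡ f_j(p) (mod 𝔪ʲ)` by induction on `j`, and `𝔪ⁿ = 0`);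
* `ker_aeval_eq_span_X_pow` — its KERNEL is `(Xⁿ)`, `n = nilpotencyClass p` (write `f = X^m · g` with `g(0) ≠ 0`, Mathlib
  `exists_eq_pow_rootMultiplicity_mul_and_not_dvd`; `g(p)` is a unit, so `f(p) = 0` forces `p^m = 0`, i.e. `n ≤ m`);
* **`nonempty_algEquiv_polynomial_quotient_X_pow`** — `A ≃ₐ[k] k[X] ⧸ (X ^ nilpotencyClass p)`;
  **`exists_nonempty_algEquiv_polynomial_quotient_X_pow_of_finrank_cotangentSpace_le_one`** — the cotangent form `∃ n, A ≃ₐ[k] k[X]/(Xⁿ)`.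

## Mathlib / tree search

Mathlib: `Polynomial.aeval`, `Ideal.quotientKerAlgEquivOfSurjective`, `Ideal.quotientEquivAlgOfEq`,
`Polynomial.exists_eq_pow_rootMultiplicity_mul_and_not_dvd`, `Polynomial.dvd_iff_isRoot`, `nilpotencyClass` ∕ `pow_nilpotencyClass` ∕
`Nat.notMem_of_lt_sInf`, `IsLocalRing.notMem_maximalIdeal`; nothing on truncated polynomial rings as a classification
(`rg "X \^ n" Mathlib/RingTheory/Artinian` → ∅; `DualNumber` is the case `n = 2` as a definition only).  Tree: ★
`MonogenicLocalAlgebraIdeals` (§1 there: `isNilpotent_of_maximalIdeal_eq_span`), ★ `SpecialPrincipalIdealRings`.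
-/

namespace Literature.RingTheory.PrincipalIdealRing

open IsLocalRing Module Polynomial

universe u v

variable {k : Type u} [Field k] {A : Type v} [CommRing A] [Algebra k A] [IsLocalRing A] [IsArtinianRing A]

/-! ## §1 `k[X] → A`, `X ↦ p`, is onto -/

omit [IsArtinianRing A] in
/-- Approximation step behind A–M 8.8 on elements: if `𝔪 = (p)` and the residue field is `k` (`hres`), then for every `a ∈ A` and
every `j` there is `f ∈ k[X]` with `a - f(p) ∈ (pʲ)`. [cite: AtiyahMacdonald1969, Ch. 8, Prop. 8.8 (proof) and Example] -/
theorem exists_sub_aeval_mem_span_pow {p : A} (hp : maximalIdeal A = Ideal.span {p})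
    (hres : ∀ a : A, ∃ c : k, a - algebraMap k A c ∈ maximalIdeal A) (a : A) (j : ℕ) :
    ∃ f : k[X], a - aeval p f ∈ Ideal.span {p ^ j} := by
  induction j with
  | zero => exact ⟨0, by simp⟩
  | succ j ih =>
    obtain ⟨f, hf⟩ := ih
    obtain ⟨b, hb⟩ := Ideal.mem_span_singleton'.1 hf
    obtain ⟨c, hc⟩ := hres b
    rw [hp] at hc
    obtain ⟨d, hd⟩ := Ideal.mem_span_singleton'.1 hc
    refine ⟨f + C c * X ^ j, ?_⟩
    have h1 : a - aeval p (f + C c * X ^ j) = (b - algebraMap k A c) * p ^ j := by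
      rw [map_add, map_mul, aeval_C, map_pow, aeval_X, ← sub_sub, ← hb]
      ring
    rw [h1, ← hd]
    exact Ideal.mem_span_singleton'.2 ⟨d, by ring⟩

/-- **`k[X] → A`, `X ↦ p`, is SURJECTIVE** for an Artin local `k`-algebra with residue field `k` and `𝔪 = (p)`: `p` is nilpotent
(★ `isNilpotent_of_maximalIdeal_eq_span`), so the approximation `a ≡ f(p) (mod pʲ)` is exact for `j` large — A–M: «hence `𝔞` is
principal», here for elements: `A = k[p]`. [cite: AtiyahMacdonald1969, Ch. 8, Prop. 8.8 (proof) and Example] -/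
theorem aeval_surjective_of_maximalIdeal_eq_span {p : A} (hp : maximalIdeal A = Ideal.span {p})
    (hres : ∀ a : A, ∃ c : k, a - algebraMap k A c ∈ maximalIdeal A) :
    Function.Surjective (aeval (R := k) p) := by
  intro a
  obtain ⟨n, hn⟩ := isNilpotent_of_maximalIdeal_eq_span hp
  obtain ⟨f, hf⟩ := exists_sub_aeval_mem_span_pow hp hres a n
  rw [hn, Ideal.span_singleton_zero, Ideal.mem_bot, sub_eq_zero] at hf
  exact ⟨f, hf.symm⟩

/-! ## §2 The kernel is `(Xⁿ)`, `n` the index of nilpotency of `p` -/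

omit [IsArtinianRing A] in
/-- For `g ∈ k[X]` with `g(0) ≠ 0`, `g(p)` is a unit of the local ring `A` when `p ∈ 𝔪` (`g(p) ≡ g(0)` modulo `𝔪`).
[cite: AtiyahMacdonald1969, Ch. 8, Prop. 8.8 (proof) and Example] -/
theorem isUnit_aeval_of_not_isRoot_zero {p : A} (hpm : p ∈ maximalIdeal A) {g : k[X]} (hg : ¬ g.IsRoot 0) :
    IsUnit (aeval p g) := by
  rw [← notMem_maximalIdeal]
  intro hmem
  -- `g = c + X * h` with `c = g(0) ≠ 0`, so `g(p) - c ∈ (p) ⊆ 𝔪`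
  obtain ⟨c, h, hh, hc0⟩ : ∃ (c : k) (h : k[X]), g = C c + X * h ∧ c ≠ 0 := by
    have hdvd : X ∣ g - C (g.eval 0) := by
      rw [X_dvd_iff, coeff_sub, coeff_C_zero, coeff_zero_eq_eval_zero, sub_self]
    obtain ⟨h, hh⟩ := hdvd
    exact ⟨g.eval 0, h, by rw [← hh]; ring, hg⟩
  have hdiff : aeval p g - algebraMap k A c ∈ maximalIdeal A := by
    rw [hh, map_add, map_mul, aeval_C, aeval_X, add_sub_cancel_left]
    exact Ideal.mul_mem_right _ _ hpm
  have hc : algebraMap k A c ∈ maximalIdeal A := by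
    have := Ideal.sub_mem _ hmem hdiff
    rwa [sub_sub_cancel] at this
  have hunit : IsUnit (algebraMap k A c) := (IsUnit.mk0 _ hc0).map _
  exact (notMem_maximalIdeal.2 hunit) hc

/-- **The kernel of `k[X] → A`, `X ↦ p`, is `(Xⁿ)` with `n = nilpotencyClass p`** (for `𝔪 = (p)` in an Artin local `k`-algebra):
`pⁿ = 0` gives `⊇`; conversely write `f = X^m · g` with `g(0) ≠ 0` (Mathlib `exists_eq_pow_rootMultiplicity_mul_and_not_dvd`); then
`f(p) = p^m · g(p)` with `g(p)` a unit, so `f(p) = 0` forces `p^m = 0`, i.e. `n ≤ m` and `Xⁿ ∣ f`.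
[cite: AtiyahMacdonald1969, Ch. 8, Prop. 8.8 (proof) and Example] -/
theorem ker_aeval_eq_span_X_pow {p : A} (hp : maximalIdeal A = Ideal.span {p}) :
    RingHom.ker (aeval (R := k) p : k[X] →ₐ[k] A) = Ideal.span {(X : k[X]) ^ nilpotencyClass p} := by
  have hnil := isNilpotent_of_maximalIdeal_eq_span hp
  have hpm : p ∈ maximalIdeal A := hp ▸ Ideal.mem_span_singleton_self p
  ext f
  rw [RingHom.mem_ker, Ideal.mem_span_singleton]
  constructor
  · intro hf
    by_cases hf0 : f = 0
    · rw [hf0]; exact dvd_zero _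
    obtain ⟨g, hfg, hg⟩ := exists_eq_pow_rootMultiplicity_mul_and_not_dvd f hf0 0
    rw [dvd_iff_isRoot] at hg
    rw [map_zero, sub_zero] at hfg
    -- `f(p) = p^m g(p)` with `g(p)` a unit ⇒ `p^m = 0`
    have hpm0 : p ^ rootMultiplicity 0 f = 0 := by
      have h1 : aeval p f = p ^ rootMultiplicity 0 f * aeval p g := by
        conv_lhs => rw [hfg]
        rw [map_mul, map_pow, aeval_X]
      rw [(show (aeval p) f = 0 from hf)] at h1
      exact ((isUnit_aeval_of_not_isRoot_zero hpm hg).mul_left_eq_zero).1 h1.symm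
    -- hence `nilpotencyClass p ≤ m`
    have hle : nilpotencyClass p ≤ rootMultiplicity 0 f := by
      by_contra hlt
      exact Nat.notMem_of_lt_sInf (not_le.1 hlt) hpm0
    rw [hfg]
    exact Dvd.dvd.mul_right (pow_dvd_pow X hle) g
  · rintro ⟨g, rfl⟩
    change aeval p (X ^ nilpotencyClass p * g) = 0
    rw [map_mul, map_pow, aeval_X, pow_nilpotencyClass hnil, zero_mul]

/-! ## §3 The classification `A ≃ₐ[k] k[X] ⧸ (Xⁿ)` -/

/-- **An Artin local `k`-algebra with residue field `k` and principal maximal ideal `𝔪 = (p)` is `k[X]/(Xⁿ)`, `n = nilpotencyClass p`**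
(A–M Example after Prop. 8.8: «`k[x]/(xⁿ)` satisfies the conditions of (8.8)» — and conversely every such algebra is of this form).
[cite: AtiyahMacdonald1969, Ch. 8, Prop. 8.8 and Example] -/
theorem nonempty_algEquiv_polynomial_quotient_X_pow {p : A} (hp : maximalIdeal A = Ideal.span {p})
    (hres : ∀ a : A, ∃ c : k, a - algebraMap k A c ∈ maximalIdeal A) :
    Nonempty (A ≃ₐ[k] (k[X] ⧸ Ideal.span {(X : k[X]) ^ nilpotencyClass p})) := by
  have e₁ := Ideal.quotientKerAlgEquivOfSurjective (aeval_surjective_of_maximalIdeal_eq_span hp hres)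
  have e₂ := Ideal.quotientEquivAlgOfEq k (ker_aeval_eq_span_X_pow (k := k) hp)
  exact ⟨e₁.symm.trans e₂⟩

/-- **Cotangent form**: an Artin local `k`-algebra with residue field `k` (elementwise: `hres`) and `dim 𝔪/𝔪² ≤ 1` is `k[X]/(Xⁿ)` for
some `n` (A–M 8.8 iii) ⇒ ii) gives a generator of `𝔪`, then `nonempty_algEquiv_polynomial_quotient_X_pow`).
[cite: AtiyahMacdonald1969, Ch. 8, Prop. 8.8 and Example] -/
theorem exists_nonempty_algEquiv_polynomial_quotient_X_pow_of_finrank_cotangentSpace_le_one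
    (h : finrank (ResidueField A) (CotangentSpace A) ≤ 1)
    (hres : ∀ a : A, ∃ c : k, a - algebraMap k A c ∈ maximalIdeal A) :
    ∃ n : ℕ, Nonempty (A ≃ₐ[k] (k[X] ⧸ Ideal.span {(X : k[X]) ^ n})) := by
  obtain ⟨p, hp⟩ := (maximalIdeal_isPrincipal_of_finrank_cotangentSpace_le_one h).principal
  exact ⟨nilpotencyClass p, nonempty_algEquiv_polynomial_quotient_X_pow hp hres⟩

end Literature.RingTheory.PrincipalIdealRing
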